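import Mathlib
import Literature.NumberTheory.LFunctions.Zhang2022.Section16ResidueDischarge
import HarnessLib

/-!
# Zhang (2022) §16 p. 95, `Z22:§16.u043` in RELATIVE form, II: `ℛ₂₂ = −(β₁L′(1,χ))⁻¹(1 + O(𝓛⁻⁶))`

Topic `Literature/NumberTheory/LFunctions/Zhang2022` (Landau–Siegel audit tree; verdict-neutral).
Y. Zhang, *Discrete mean estimates and the Landau–Siegel zero*, arXiv:2211.02515v1 (2022)
[Zhang2022LandauSiegel] — **an unrefereed manuscript under adjudication** (ZHANG-L discharge lane,
G-row G-d49-1). DISCHARGE file (theorems only; no new definitions, no new facts); no statement about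
Theorems 1–2 of the manuscript or about Landau–Siegel zeros is made or implied.

Second half of the relative reading of `Z22:§16.u043` [Z22 p.95, tex L4674–L4677]: the residue
`ℛ₂₂` of (16.11) at `s = −β₂` satisfies `β₁L′(1,χ)ℛ₂₂ = −1 + O(𝓛⁻⁶)` — the tree's
`ResidueValues.calR2_two_estimate` (`Section16ResidueDischarge`: `ℛ₂₂ = N·q·Z_u·Z₂⁻¹·Λ₂⁻¹`,
`N = −1/(β₁L′)`, each factor `1 + O(𝓛⁻⁶)`) read off BEFORE multiplying by `|N| ≤ 2𝓛⁹/(πc)`; the proof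
is that one verbatim up to its last lines. Companion of `Section16ResidueEstimatesRel` (`ℛ₂*`, `ℛ₂₁`);
consumed by `Section16U045Printed` (u044 at the computed rate `𝓛⁻⁶`, u045 AS PRINTED from
(16.12) + (16.16); GAP-LEDGER G-d49-1 repair "(a)").

* `calR2_two_rel_estimate`: `‖β₁L′(1,χ)ℛ₂₂ + 1‖ ≤ C𝓛⁻⁶` for all large `D` under (A), every `c′`.

## References

* Y. Zhang, arXiv:2211.02515v1 (2022), §16 p. 95 (u043), §5 Lemmas 5.7, 5.8.
  [cite: Zhang2022LandauSiegel, §16 p.95; §5 Lemmas 5.7, 5.8]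
-/

noncomputable section

open Complex Real Filter Topology


namespace Literature.NumberTheory.LFunctions.Zhang2022.ResidueValues

open Skeleton Typed.Section16A Typed.Section16B

variable (c' : ℝ)

/-! ## `ℛ₂₂ = −(β₁L′(1,χ))⁻¹(1 + O(𝓛⁻⁶))` -/

set_option maxHeartbeats 400000 in
/-- **`β₁L′(1,χ)·ℛ₂₂ = −1 + O(𝓛⁻⁶)`** (§16 p. 95, second half of `Z22:§16.u043`, `j = 2`, in RELATIVE
form): the proof of `calR2_two_estimate` verbatim — `ℛ₂₂ = N·q·Z_u·Z₂⁻¹·Λ₂⁻¹`, each factor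
`1 + O(𝓛⁻⁶)`. [cite: Zhang2022LandauSiegel, §16 p. 95] -/

theorem calR2_two_rel_estimate :
    ∃ C : ℝ, 0 ≤ C ∧ ForAllLarge fun D _ χ => AssumptionA D χ →
      ‖beta1 c' D * deriv χ.LFunction 1 * calR2 c' χ 2 + 1‖ ≤ C * (ell D ^ 6)⁻¹ := by
  obtain ⟨c, hc, h57⟩ := norm_deriv_LFunction_one_ge
  obtain ⟨r, hr, K, hK, hζ⟩ := zeta_shift_bounds
  obtain ⟨CL, hCL0, hLb⟩ := L_one_sub_beta_bounds
  obtain ⟨D₀, hall⟩ := h57.and hLb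
  set Ktot : ℝ := 8 * (24 * (|c'| * π)) + 6 * (16 * K * π) + 2 * CL with hKtot
  have hKtot0 : 0 ≤ Ktot := by positivity
  refine ⟨Ktot, hKtot0,
    max D₀ (max (max ⌈Real.exp 3⌉₊ ⌈Real.exp (14 * |c'| * π)⌉₊)
      (max ⌈Real.exp (8 * π / r + 1)⌉₊ ⌈Real.exp (16 * K * π + 1)⌉₊)), fun D _ χ hD hq hp hA => ?_⟩
  have hD₀ : D₀ ≤ D := le_trans (le_max_left _ _) hD
  have hD1 := le_trans (le_trans (le_max_left _ _) (le_max_right _ _)) hD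
  have hD2 := le_trans (le_trans (le_max_left _ _) (le_trans (le_max_right _ _) (le_max_right _ _))) hD
  have hD3 := le_trans (le_trans (le_max_right _ _) (le_trans (le_max_right _ _) (le_max_right _ _))) hD
  obtain ⟨hL, he⟩ := thresholds c' hD1
  have hℓ : 0 < ell D := by linarith
  have hℓ1 : 1 ≤ ell D := by linarith
  have hα := alpha_pos hL
  have hαeq := Section2.alpha_eq_pi_div_ell9 D
  have hαℓ9 : alpha D * ell D ^ 9 = π := by rw [hαeq]; field_simp
  have hlogD2 : 8 * π / r + 1 ≤ ell D := by
    have h : Real.exp (8 * π / r + 1) ≤ D := le_trans (Nat.le_ceil _) (by exact_mod_cast hD2)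
    exact (Real.le_log_iff_exp_le (lt_of_lt_of_le (Real.exp_pos _) h)).mpr h
  have hlogD3 : 16 * K * π + 1 ≤ ell D := by
    have h : Real.exp (16 * K * π + 1) ≤ D := le_trans (Nat.le_ceil _) (by exact_mod_cast hD3)
    exact (Real.le_log_iff_exp_le (lt_of_lt_of_le (Real.exp_pos _) h)).mpr h
  have h8α : 8 * alpha D < r := by
    have h1 : alpha D ≤ π / ell D := alpha_le hL
    have h2 : 8 * π / r < ell D := by linarith
    calc 8 * alpha D ≤ 8 * (π / ell D) := by linarith
      _ = (8 * π / r) * (r / ell D) := by field_simp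
      _ < ell D * (r / ell D) := by gcongr
      _ = r := by field_simp
  -- `8Kα ≤ 1/2`
  have hK8α : K * (8 * alpha D) ≤ 1 / 2 := by
    calc K * (8 * alpha D) ≤ K * (8 * (π / ell D)) := by gcongr; exact alpha_le hL
      _ = 8 * K * π / ell D := by ring
      _ ≤ 1 / 2 := by
          rw [div_le_iff₀ hℓ]
          nlinarith [mul_nonneg hK Real.pi_pos.le]
  obtain ⟨g57, gL⟩ := hall D χ hD₀ hq hp
  clear hall
  have hcL := g57 hA
  clear g57
  set L1 : ℂ := deriv χ.LFunction 1 with hL1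
  have hN : 0 < ‖L1‖ := lt_of_lt_of_le hc hcL
  have hL0 : L1 ≠ 0 := fun h => by rw [h, norm_zero] at hN; exact lt_irrefl _ hN
  have hχ1 : χ ≠ 1 := by
    have hD1' : D ≠ 1 := by
      rintro rfl; norm_num [ell] at hL
    exact GammaFactor.ne_one_of_isPrimitive hp hD1'
  -- sizes of the shifts
  have he' := abs_le.mp he
  obtain ⟨hβ1l, hβ2l, -⟩ := norm_beta_ge c' hL he
  have hβ1u := norm_beta1_le c' hL he
  have hβ2u := norm_beta2_le c' hL he
  obtain ⟨⟨h21l, h21u⟩, -, -⟩ := norm_beta_sub c' hL he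
  have hβ1ne : beta1 c' D ≠ 0 := fun h => by rw [h, norm_zero] at hβ1l; linarith
  have hβ2ne : beta2 c' D ≠ 0 := fun h => by rw [h, norm_zero] at hβ2l; linarith
  have h12ne : beta1 c' D - beta2 c' D ≠ 0 := by
    intro h; apply (fun h' => by rw [h', norm_zero] at h21l; linarith : beta2 c' D - beta1 c' D ≠ 0)
    linear_combination -h
  have h12u : ‖beta1 c' D - beta2 c' D‖ ≤ 8 * alpha D := by rw [norm_sub_rev]; exact h21u
  have hP := P4_pos hL
  -- the `ζ` factors: `Z_u = uζ(1+u)`, `u = β₁−β₂`, and `Z₂ = (−β₂)ζ(1−β₂)`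
  have hu : ‖beta1 c' D - beta2 c' D‖ < r := lt_of_le_of_lt h12u h8α
  obtain ⟨-, hZu1, -⟩ := hζ (beta1 c' D - beta2 c' D) h12ne hu
  have hu2 : ‖-beta2 c' D‖ < r := by rw [norm_neg]; linarith
  obtain ⟨hζne, hZ21, hZ2half⟩ := hζ (-beta2 c' D) (neg_ne_zero.mpr hβ2ne) hu2
  clear hζ
  have hζne' : riemannZeta (1 - beta2 c' D) ≠ 0 := by rw [sub_eq_add_neg]; exact hζne
  set Zu : ℂ := (beta1 c' D - beta2 c' D) * riemannZeta (1 + (beta1 c' D - beta2 c' D)) with hZudef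
  have tZu : ‖Zu - 1‖ ≤ 16 * K * π / ell D ^ 9 := by
    calc ‖Zu - 1‖ ≤ K * ‖beta1 c' D - beta2 c' D‖ := hZu1
      _ ≤ K * (8 * alpha D) := by gcongr
      _ = 8 * K * π / ell D ^ 9 := by rw [hαeq]; ring
      _ ≤ 16 * K * π / ell D ^ 9 := by gcongr; nlinarith [mul_nonneg hK Real.pi_pos.le]
  set Z2 : ℂ := -beta2 c' D * riemannZeta (1 - beta2 c' D) with hZ2def
  have hZ21' : ‖Z2 - 1‖ ≤ K * ‖-beta2 c' D‖ := by rw [hZ2def, sub_eq_add_neg]; exact hZ21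
  have hZ2half' : ‖Z2 - 1‖ ≤ 1 / 2 := by rw [hZ2def, sub_eq_add_neg]; exact hZ2half
  have tZ2 : ‖Z2⁻¹ - 1‖ ≤ 16 * K * π / ell D ^ 9 := by
    have h := norm_inv_sub_one_le hZ21' (by
      calc K * ‖-beta2 c' D‖ ≤ K * (8 * alpha D) := by rw [norm_neg]; gcongr; linarith
        _ ≤ 1 / 2 := hK8α)
    calc ‖Z2⁻¹ - 1‖ ≤ 2 * (K * ‖-beta2 c' D‖) := h
      _ ≤ 2 * (K * (4 * alpha D)) := by rw [norm_neg]; gcongr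
      _ = 8 * K * π / ell D ^ 9 := by rw [hαeq]; ring
      _ ≤ 16 * K * π / ell D ^ 9 := by gcongr; nlinarith [mul_nonneg hK Real.pi_pos.le]
  have tZ1 : 16 * K * π / ell D ^ 9 ≤ 1 := by
    rw [div_le_one (pow_pos hℓ 9)]
    calc 16 * K * π ≤ ell D := by linarith
      _ = ell D ^ 1 := (pow_one _).symm
      _ ≤ ell D ^ 9 := pow_le_pow_right₀ hℓ1 (by norm_num)
  -- the `L` factor `Λ₂ = L(1−β₂)/(−β₂L′)`
  obtain ⟨hLne, hΛ, hΛhalf⟩ := gL hA (beta2 c' D) hβ2l hβ2u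
  clear gL
  set Λ : ℂ := χ.LFunction (1 - beta2 c' D) / (-beta2 c' D * L1) with hΛdef
  have tΛ : ‖Λ⁻¹ - 1‖ ≤ 2 * (CL / ell D ^ 6) := norm_inv_sub_one_le hΛ hΛhalf
  have tΛ1 : 2 * (CL / ell D ^ 6) ≤ 1 := by linarith
  -- the main factor `q = (−β₁)/(β₁−β₂) = (1−5e)/(1+7e)`
  have h7 : (1 + 7 * (c' * alpha D * ell D) : ℝ) ≠ 0 := by
    intro h; have := he'.1; linarith
  set q : ℂ := -beta1 c' D / (beta1 c' D - beta2 c' D) with hqdef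
  have hq : q = (((1 - 5 * (c' * alpha D * ell D)) / (1 + 7 * (c' * alpha D * ell D)) : ℝ) : ℂ) := by
    rw [hqdef, beta1_eq, beta2_eq]
    have h7c : ((1 + 7 * (c' * alpha D * ell D) : ℝ) : ℂ) ≠ 0 := Complex.ofReal_ne_zero.mpr h7
    have hαc : ((alpha D : ℝ) : ℂ) ≠ 0 := Complex.ofReal_ne_zero.mpr hα.ne'
    push_cast at h7c ⊢
    have hden : I * (↑(alpha D) * (1 - 5 * (↑c' * ↑(alpha D) * ↑(ell D)))) -
        I * (↑(alpha D) * (2 + 2 * (↑c' * ↑(alpha D) * ↑(ell D)))) =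
        -(I * ↑(alpha D)) * (1 + 7 * (↑c' * ↑(alpha D) * ↑(ell D))) := by ring
    rw [hden]
    field_simp
  have tq : ‖q - 1‖ ≤ 24 * |c' * alpha D * ell D| := by
    rw [hq, ← Complex.ofReal_one, ← Complex.ofReal_sub, Complex.norm_real, Real.norm_eq_abs]
    exact abs_ratio15_sub_one_le he
  -- the closed form and the identity
  have hval := calR2_two_eq c' χ hχ1 hP h12ne hβ2ne hζne' hLne
  rw [sub_self, Complex.cpow_zero, one_mul] at hval
  have hω0 : GaussWeight.omega1 (ell D ^ 30) 0 = 1 := by simp [GaussWeight.omega1]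
  rw [hω0, mul_one] at hval
  set N : ℂ := -1 / (beta1 c' D * L1) with hNdef
  have hid : calR2 c' χ 2 + 1 / (beta1 c' D * L1) = N * (q * Zu * Z2⁻¹ * Λ⁻¹ - 1) := by
    rw [hval]
    have h := residue_identity_two (ζ := riemannZeta (1 + beta1 c' D - beta2 c' D)) hβ1ne hβ2ne hL0
      h12ne hζne' hLne
    rw [h, hNdef, hqdef, hZudef, hZ2def, hΛdef, add_sub_assoc]
  -- the RELATIVE form: `β₁L′(1,χ)·ℛ₂₂ + 1 = −(q * Zu * Z2⁻¹ * Λ⁻¹ − 1)`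
  have hid2 : beta1 c' D * L1 * calR2 c' χ 2 + 1 = -(q * Zu * Z2⁻¹ * Λ⁻¹ - 1) := by
    have e1 : beta1 c' D * L1 * (1 / (beta1 c' D * L1)) = 1 := by field_simp
    have e2 : beta1 c' D * L1 * N = -1 := by rw [hNdef]; field_simp
    calc beta1 c' D * L1 * calR2 c' χ 2 + 1
        = beta1 c' D * L1 * (calR2 c' χ 2 + 1 / (beta1 c' D * L1)) := by rw [mul_add, e1]
      _ = beta1 c' D * L1 * (N * (q * Zu * Z2⁻¹ * Λ⁻¹ - 1)) := by rw [hid]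
      _ = -(q * Zu * Z2⁻¹ * Λ⁻¹ - 1) := by rw [← mul_assoc, e2, neg_one_mul]
  rw [hid2, norm_neg]
  have hprod : ‖q * Zu * Z2⁻¹ * Λ⁻¹ - 1‖ ≤
      2 * (2 * (2 * (24 * |c' * alpha D * ell D|) + 16 * K * π / ell D ^ 9) + 16 * K * π / ell D ^ 9) +
        2 * (CL / ell D ^ 6) := by
    have s1 := norm_mul_sub_one_le tq tZu tZ1
    have s2 := norm_mul_sub_one_le s1 tZ2 tZ1
    exact norm_mul_sub_one_le s2 tΛ tΛ1
  have h1 : |c' * alpha D * ell D| = |c'| * π / ell D ^ 8 := abs_e_eq c' hL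
  have hsmall : 2 * (2 * (2 * (24 * |c' * alpha D * ell D|) + 16 * K * π / ell D ^ 9) +
      16 * K * π / ell D ^ 9) + 2 * (CL / ell D ^ 6) ≤ Ktot / ell D ^ 6 := by
    have p6 : (0 : ℝ) < ell D ^ 6 := pow_pos hℓ 6
    have i1 : |c' * alpha D * ell D| ≤ |c'| * π / ell D ^ 6 := by
      rw [h1]; exact div_le_div_of_nonneg_left (by positivity) p6 (pow_le_pow_right₀ hℓ1 (by norm_num))
    have i4 : 16 * K * π / ell D ^ 9 ≤ 16 * K * π / ell D ^ 6 :=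
      div_le_div_of_nonneg_left (by positivity) p6 (pow_le_pow_right₀ hℓ1 (by norm_num))
    rw [hKtot]
    have eq : (8 * (24 * (|c'| * π)) + 6 * (16 * K * π) + 2 * CL) / ell D ^ 6 =
        8 * (24 * (|c'| * π / ell D ^ 6)) + 6 * (16 * K * π / ell D ^ 6) + 2 * (CL / ell D ^ 6) := by
      field_simp
    rw [eq]
    linarith only [i1, i4, hCL0, hK, Real.pi_pos]
  calc ‖q * Zu * Z2⁻¹ * Λ⁻¹ - 1‖ ≤ Ktot / ell D ^ 6 := hprod.trans hsmall
    _ = Ktot * (ell D ^ 6)⁻¹ := div_eq_mul_inv _ _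

end Literature.NumberTheory.LFunctions.Zhang2022.ResidueValues
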